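import Mathlib
import Summits.SmoothPoincare4.SmoothPoincare4.Theorems.SullivanDualTameOrBrodyR4PencilDefs

/-!
# A global smooth complex trivialisation standard at infinity (crux `TameOrBrodyR4`, stmt-SmoothPoincare4-7826, line `Sketch`, stub `helper_complexTrivialisation`)

Let `J` be a `C^∞` almost complex structure on `ℝ⁴` (`J_x² = -1`) which, in a coordinate frame
`(P, Q)` with sections `(eP, eQ)`, is the standard structure `I₀ v = eP (i P v) + eQ (i Q v)` on
`‖x‖ ≥ R`, and let `γ : ℂ → ℝ⁴` be `C^∞` with `|P (γ ξ)| ≥ R` for `‖ξ‖ ≥ ρ₀` and `|Q ∘ γ| ≤ B`.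
We build `C^∞` families `Ψ₀, Ψ₀inv : ℂ → (ℝ⁴ →L[ℝ] ℝ⁴)`, inverse to each other, uniformly
bounded, with `Ψ₀ ξ ∘ I₀ = J (γ ξ) ∘ Ψ₀ ξ` and `Ψ₀ ξ = id` for `‖ξ‖ ≥ ρ₀`.

Construction (elementary, no bundle theory): for two complex structures `J₁, J₀` on a vector
space the CANONICAL INTERTWINER `Φ(J₁, J₀) = 1 - ½ J₁ (J₀ - J₁) = ½ (1 - J₁ J₀)` satisfies
`J₁ Φ = Φ J₀`, `Φ(J, J) = 1` and `‖Φ - 1‖ ≤ ½ ‖J₁‖ ‖J₀ - J₁‖`, so it is invertible with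
`‖Φ⁻¹‖ ≤ 2` as soon as `‖J₁‖ ≤ A`, `‖J₀ - J₁‖ ≤ A⁻¹` (Neumann series).  Translating `γ` far
out in the `Q`-direction, `x_k ξ = γ ξ + eQ ((N - k) δ)`, gives finitely many structures
`J_k ξ = J (x_k ξ)` with `J_0 ξ = I₀` (the point `x_0 ξ` is far), `J_N ξ = J (γ ξ)`, consecutive
ones `A⁻¹`-close (`J` is globally Lipschitz, being smooth and constant outside a ball), and ALL
equal for `‖ξ‖ ≥ ρ₀`; the finite product `Ψ₀ ξ = Φ(J_N ξ, J_{N-1} ξ) ∘ ⋯ ∘ Φ(J_1 ξ, J_0 ξ)` is the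
trivialisation, its inverse is the product of the inverses in the reverse order.
-/

-- the registered namespace `Summit.SmoothPoincare4.SmoothPoincare4.…` repeats a component
set_option linter.dupNamespace false

noncomputable section

open scoped ContDiff Topology
open Filter Set Metric

namespace Summit.SmoothPoincare4.SmoothPoincare4.Cruxes.TameOrBrodyR4.Sketch

/-- Local notation for the model space `ℝ⁴ = EuclideanSpace ℝ (Fin 4)`. -/
local notation "E4" => EuclideanSpace ℝ (Fin 4)

namespace ComplexTrivialisation

variable {𝔸 : Type*} [NormedRing 𝔸] [NormedAlgebra ℝ 𝔸]

/-! ### The canonical intertwiner of two complex structures -/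

/-- The canonical intertwiner `Φ(J₁, J₀) = 1 - ½ J₁ (J₀ - J₁)` (equal to `½ (1 - J₁ J₀)` when
`J₁² = -1`) from the complex structure `J₀` to the complex structure `J₁`. -/
def phi (J₁ J₀ : 𝔸) : 𝔸 := 1 - (1 / 2 : ℝ) • (J₁ * (J₀ - J₁))

/-- `Φ(J, J) = 1`. -/
theorem phi_self (J : 𝔸) : phi J J = 1 := by
  simp [phi]

/-- `1 - Φ(J₁, J₀) = ½ J₁ (J₀ - J₁)`. -/
theorem one_sub_phi (J₁ J₀ : 𝔸) : 1 - phi J₁ J₀ = (1 / 2 : ℝ) • (J₁ * (J₀ - J₁)) := by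
  simp [phi]

/-- The intertwining property `J₁ Φ(J₁, J₀) = Φ(J₁, J₀) J₀` of two complex structures. -/
theorem mul_phi {J₁ J₀ : 𝔸} (h₁ : J₁ * J₁ = -1) (h₀ : J₀ * J₀ = -1) :
    J₁ * phi J₁ J₀ = phi J₁ J₀ * J₀ := by
  have e1 : J₁ * (J₁ * (J₀ - J₁)) = -(J₀ - J₁) := by
    rw [← mul_assoc, h₁, neg_one_mul]
  have e2 : J₁ * (J₀ - J₁) * J₀ = J₀ - J₁ := by
    rw [mul_assoc, sub_mul, h₀, mul_sub, ← mul_assoc, h₁, mul_neg_one, neg_one_mul, sub_neg_eq_add,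
      neg_add_eq_sub]
  have lhs : J₁ * phi J₁ J₀ = J₁ + (1 / 2 : ℝ) • (J₀ - J₁) := by
    show J₁ * (1 - (1 / 2 : ℝ) • (J₁ * (J₀ - J₁))) = _
    rw [mul_sub, mul_one, mul_smul_comm, e1, smul_neg, sub_neg_eq_add]
  have rhs : phi J₁ J₀ * J₀ = J₀ - (1 / 2 : ℝ) • (J₀ - J₁) := by
    show (1 - (1 / 2 : ℝ) • (J₁ * (J₀ - J₁))) * J₀ = _
    rw [sub_mul, one_mul, smul_mul_assoc, e2]
  rw [lhs, rhs]
  module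

/-- Smallness of `Φ - 1`: `‖1 - Φ(J₁, J₀)‖ ≤ ½` when `‖J₁‖ ≤ A` and `‖J₀ - J₁‖ ≤ A⁻¹`. -/
theorem norm_one_sub_phi_le {J₁ J₀ : 𝔸} {A : ℝ} (hA : 0 < A) (h₁ : ‖J₁‖ ≤ A)
    (hd : ‖J₀ - J₁‖ ≤ A⁻¹) : ‖1 - phi J₁ J₀‖ ≤ 1 / 2 := by
  rw [one_sub_phi, norm_smul, Real.norm_of_nonneg (by norm_num : (0 : ℝ) ≤ 1 / 2)]
  have : ‖J₁ * (J₀ - J₁)‖ ≤ 1 :=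
    calc ‖J₁ * (J₀ - J₁)‖ ≤ ‖J₁‖ * ‖J₀ - J₁‖ := norm_mul_le _ _
      _ ≤ A * A⁻¹ := mul_le_mul h₁ hd (norm_nonneg _) hA.le
      _ = 1 := mul_inv_cancel₀ hA.ne'
  linarith

/-- Norm bound `‖Φ(J₁, J₀)‖ ≤ 2` (given `‖1‖ ≤ 1`). -/
theorem norm_phi_le (h1 : ‖(1 : 𝔸)‖ ≤ 1) {J₁ J₀ : 𝔸} {A : ℝ} (hA : 0 < A) (h₁ : ‖J₁‖ ≤ A)
    (hd : ‖J₀ - J₁‖ ≤ A⁻¹) : ‖phi J₁ J₀‖ ≤ 2 := by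
  have h := norm_one_sub_phi_le hA h₁ hd
  calc ‖phi J₁ J₀‖ = ‖1 - (1 - phi J₁ J₀)‖ := by rw [sub_sub_cancel]
    _ ≤ ‖(1 : 𝔸)‖ + ‖1 - phi J₁ J₀‖ := norm_sub_le _ _
    _ ≤ 2 := by linarith

/-! ### The finite product of intertwiners along a sequence of structures -/

/-- The product `Ψ_k = Φ(J_k, J_{k-1}) ⋯ Φ(J_1, J_0)` of the canonical intertwiners along a sequence
`J_0, J_1, …` of families of complex structures (`Ψ_0 = 1`). -/
def psi (Js : ℕ → ℂ → 𝔸) : ℕ → ℂ → 𝔸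
  | 0 => fun _ => 1
  | k + 1 => fun ξ => phi (Js (k + 1) ξ) (Js k ξ) * psi Js k ξ

/-- The product `Φ(J_1, J_0)⁻¹ ⋯ Φ(J_k, J_{k-1})⁻¹` of the inverses in the reverse order. -/
def psiInv (Js : ℕ → ℂ → 𝔸) : ℕ → ℂ → 𝔸
  | 0 => fun _ => 1
  | k + 1 => fun ξ => psiInv Js k ξ * Ring.inverse (phi (Js (k + 1) ξ) (Js k ξ))

variable (Js : ℕ → ℂ → 𝔸)

/-- Unfolding `Ψ_{k+1}`. -/
theorem psi_succ (k : ℕ) (ξ : ℂ) :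
    psi Js (k + 1) ξ = phi (Js (k + 1) ξ) (Js k ξ) * psi Js k ξ := rfl

/-- Unfolding `Ψinv_{k+1}`. -/
theorem psiInv_succ (k : ℕ) (ξ : ℂ) :
    psiInv Js (k + 1) ξ = psiInv Js k ξ * Ring.inverse (phi (Js (k + 1) ξ) (Js k ξ)) := rfl

/-- Intertwining: `Ψ_k J_0 = J_k Ψ_k`. -/
theorem psi_mul (hsq : ∀ k ξ, Js k ξ * Js k ξ = -1) (k : ℕ) (ξ : ℂ) :
    psi Js k ξ * Js 0 ξ = Js k ξ * psi Js k ξ := by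
  induction k with
  | zero => simp [psi]
  | succ k ih =>
    rw [psi_succ, mul_assoc, ih, ← mul_assoc, ← mul_phi (hsq (k + 1) ξ) (hsq k ξ), mul_assoc]

/-- Where consecutive structures agree up to step `k`, `Ψ_k = 1`. -/
theorem psi_eq_one (k : ℕ) (ξ : ℂ) (h : ∀ j < k, Js (j + 1) ξ = Js j ξ) : psi Js k ξ = 1 := by
  induction k with
  | zero => rfl
  | succ k ih =>
    rw [psi_succ, h k (Nat.lt_succ_self k), phi_self, one_mul,
      ih fun j hj => h j (Nat.lt_succ_of_lt hj)]

/-- Smoothness of one factor `ξ ↦ Φ(J_{k+1} ξ, J_k ξ)`. -/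
theorem contDiff_phi (hsm : ∀ k, ContDiff ℝ ∞ (Js k)) (k : ℕ) :
    ContDiff ℝ ∞ fun ξ => phi (Js (k + 1) ξ) (Js k ξ) := by
  show ContDiff ℝ ∞ fun ξ => 1 - (1 / 2 : ℝ) • (Js (k + 1) ξ * (Js k ξ - Js (k + 1) ξ))
  exact contDiff_const.sub (((hsm (k + 1)).mul ((hsm k).sub (hsm (k + 1)))).const_smul _)

/-- Smoothness of `Ψ_k`. -/
theorem contDiff_psi (hsm : ∀ k, ContDiff ℝ ∞ (Js k)) (k : ℕ) : ContDiff ℝ ∞ (psi Js k) := by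
  induction k with
  | zero => exact contDiff_const
  | succ k ih => exact (contDiff_phi Js hsm k).mul ih

/-- Norm bound `‖Ψ_k ξ‖ ≤ 2 ^ k`. -/
theorem norm_psi_le (h1 : ‖(1 : 𝔸)‖ ≤ 1) {A : ℝ} (hA : 0 < A) (hbd : ∀ k ξ, ‖Js k ξ‖ ≤ A)
    (hstep : ∀ k ξ, ‖Js k ξ - Js (k + 1) ξ‖ ≤ A⁻¹) (k : ℕ) (ξ : ℂ) :
    ‖psi Js k ξ‖ ≤ 2 ^ k := by
  induction k with
  | zero => simpa [psi] using h1
  | succ k ih =>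
    rw [psi_succ, pow_succ']
    exact (norm_mul_le _ _).trans
      (mul_le_mul (norm_phi_le h1 hA (hbd _ _) (hstep _ _)) ih (norm_nonneg _) zero_le_two)

section Inverse

variable [CompleteSpace 𝔸]

/-- `Φ(J₁, J₀)` is invertible when `‖J₁‖ ≤ A` and `‖J₀ - J₁‖ ≤ A⁻¹` (Neumann series). -/
theorem isUnit_phi {J₁ J₀ : 𝔸} {A : ℝ} (hA : 0 < A) (h₁ : ‖J₁‖ ≤ A) (hd : ‖J₀ - J₁‖ ≤ A⁻¹) :
    IsUnit (phi J₁ J₀) := by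
  have h := norm_one_sub_phi_le hA h₁ hd
  have hu : IsUnit (1 - (1 - phi J₁ J₀)) := isUnit_one_sub_of_norm_lt_one (by linarith)
  rwa [sub_sub_cancel] at hu

/-- The inverse of `Φ(J₁, J₀)` has norm `≤ 2` (given `‖1‖ ≤ 1`). -/
theorem norm_inverse_phi_le (h1 : ‖(1 : 𝔸)‖ ≤ 1) {J₁ J₀ : 𝔸} {A : ℝ} (hA : 0 < A)
    (h₁ : ‖J₁‖ ≤ A) (hd : ‖J₀ - J₁‖ ≤ A⁻¹) : ‖Ring.inverse (phi J₁ J₀)‖ ≤ 2 := by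
  have h := norm_one_sub_phi_le hA h₁ hd
  set y := Ring.inverse (phi J₁ J₀)
  have hmul : phi J₁ J₀ * y = 1 := Ring.mul_inverse_cancel _ (isUnit_phi hA h₁ hd)
  have hy : y = 1 + (1 - phi J₁ J₀) * y := by
    rw [sub_mul, one_mul, hmul, add_sub_cancel]
  have hle : ‖y‖ ≤ ‖(1 : 𝔸)‖ + ‖1 - phi J₁ J₀‖ * ‖y‖ :=
    calc ‖y‖ = ‖1 + (1 - phi J₁ J₀) * y‖ := by rw [← hy]
      _ ≤ ‖(1 : 𝔸)‖ + ‖(1 - phi J₁ J₀) * y‖ := norm_add_le _ _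
      _ ≤ ‖(1 : 𝔸)‖ + ‖1 - phi J₁ J₀‖ * ‖y‖ := by gcongr; exact norm_mul_le _ _
  have hy0 : 0 ≤ ‖y‖ := norm_nonneg _
  nlinarith [mul_le_mul_of_nonneg_right h hy0]

/-- `Ψinv_k` is a left inverse of `Ψ_k`. -/
theorem psiInv_mul_psi {A : ℝ} (hA : 0 < A) (hbd : ∀ k ξ, ‖Js k ξ‖ ≤ A)
    (hstep : ∀ k ξ, ‖Js k ξ - Js (k + 1) ξ‖ ≤ A⁻¹) (k : ℕ) (ξ : ℂ) :
    psiInv Js k ξ * psi Js k ξ = 1 := by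
  induction k with
  | zero => simp [psi, psiInv]
  | succ k ih =>
    rw [psi_succ, psiInv_succ, mul_assoc, ← mul_assoc (Ring.inverse _),
      Ring.inverse_mul_cancel _ (isUnit_phi hA (hbd _ _) (hstep _ _)), one_mul, ih]

/-- `Ψinv_k` is a right inverse of `Ψ_k`. -/
theorem psi_mul_psiInv {A : ℝ} (hA : 0 < A) (hbd : ∀ k ξ, ‖Js k ξ‖ ≤ A)
    (hstep : ∀ k ξ, ‖Js k ξ - Js (k + 1) ξ‖ ≤ A⁻¹) (k : ℕ) (ξ : ℂ) :
    psi Js k ξ * psiInv Js k ξ = 1 := by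
  induction k with
  | zero => simp [psi, psiInv]
  | succ k ih =>
    rw [psi_succ, psiInv_succ, mul_assoc, ← mul_assoc (psi Js k ξ), ih, one_mul,
      Ring.mul_inverse_cancel _ (isUnit_phi hA (hbd _ _) (hstep _ _))]

/-- Norm bound `‖Ψinv_k ξ‖ ≤ 2 ^ k`. -/
theorem norm_psiInv_le (h1 : ‖(1 : 𝔸)‖ ≤ 1) {A : ℝ} (hA : 0 < A) (hbd : ∀ k ξ, ‖Js k ξ‖ ≤ A)
    (hstep : ∀ k ξ, ‖Js k ξ - Js (k + 1) ξ‖ ≤ A⁻¹) (k : ℕ) (ξ : ℂ) :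
    ‖psiInv Js k ξ‖ ≤ 2 ^ k := by
  induction k with
  | zero => simpa [psiInv] using h1
  | succ k ih =>
    rw [psiInv_succ, pow_succ]
    exact (norm_mul_le _ _).trans
      (mul_le_mul ih (norm_inverse_phi_le h1 hA (hbd _ _) (hstep _ _)) (norm_nonneg _)
        (by positivity))

/-- Smoothness of the inverse factor `ξ ↦ Φ(J_{k+1} ξ, J_k ξ)⁻¹` (inversion is smooth on the units
of a Banach algebra). -/
theorem contDiff_inverse_phi (hsm : ∀ k, ContDiff ℝ ∞ (Js k)) {A : ℝ} (hA : 0 < A)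
    (hbd : ∀ k ξ, ‖Js k ξ‖ ≤ A) (hstep : ∀ k ξ, ‖Js k ξ - Js (k + 1) ξ‖ ≤ A⁻¹) (k : ℕ) :
    ContDiff ℝ ∞ fun ξ => Ring.inverse (phi (Js (k + 1) ξ) (Js k ξ)) := by
  rw [contDiff_iff_contDiffAt]
  intro ξ
  obtain ⟨u, hu⟩ := isUnit_phi hA (hbd (k + 1) ξ) (hstep k ξ)
  have h : ContDiffAt ℝ ∞ Ring.inverse (phi (Js (k + 1) ξ) (Js k ξ)) :=
    hu ▸ contDiffAt_ringInverse ℝ u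
  exact h.comp ξ (contDiff_phi Js hsm k).contDiffAt

/-- Smoothness of `Ψinv_k`. -/
theorem contDiff_psiInv (hsm : ∀ k, ContDiff ℝ ∞ (Js k)) {A : ℝ} (hA : 0 < A)
    (hbd : ∀ k ξ, ‖Js k ξ‖ ≤ A) (hstep : ∀ k ξ, ‖Js k ξ - Js (k + 1) ξ‖ ≤ A⁻¹) (k : ℕ) :
    ContDiff ℝ ∞ (psiInv Js k) := by
  induction k with
  | zero => exact contDiff_const
  | succ k ih => exact ih.mul (contDiff_inverse_phi Js hsm hA hbd hstep k)

end Inverse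

end ComplexTrivialisation

open ComplexTrivialisation in
/-- **Registered helper `helper_complexTrivialisation`.** For a `C^∞` almost complex structure `J`
on `ℝ⁴`, standard in the frame `(P, Q)` on `‖x‖ ≥ R`, and a `C^∞` map `γ : ℂ → ℝ⁴` whose
`P`-coordinate is `≥ R` outside the disc `‖ξ‖ ≤ ρ₀` and whose `Q`-coordinate is bounded, there is a
global `C^∞` complex trivialisation `Ψ₀ ξ : (ℝ⁴, I₀) → (ℝ⁴, J (γ ξ))` (`Ψ₀ ξ ∘ I₀ = J (γ ξ) ∘ Ψ₀ ξ`,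
`I₀ v = eP (i P v) + eQ (i Q v)`) with a `C^∞` two-sided inverse family, uniform bounds, and
`Ψ₀ ξ = id` for `‖ξ‖ ≥ ρ₀` (a finite product of canonical intertwiners along the translation of
`γ` to the standard end). -/
theorem helper_complexTrivialisation (J : E4 → E4 →L[ℝ] E4) (R : ℝ) (P Q : E4 →L[ℝ] ℂ)
    (eP eQ : ℂ →L[ℝ] E4) (hR : 0 < R) (hJs : ContDiff ℝ ∞ J) (hJ2 : ∀ x v, J x (J x v) = -v)
    (hPQ : IsCoordFrame P Q eP eQ)
    (hJP : ∀ x : E4, R ≤ ‖x‖ → ∀ v, P (J x v) = Complex.I * P v)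
    (hJQ : ∀ x : E4, R ≤ ‖x‖ → ∀ v, Q (J x v) = Complex.I * Q v) (γ : ℂ → E4)
    (hγ : ContDiff ℝ ∞ γ) (ρ₀ B : ℝ) (hfar : ∀ ξ : ℂ, ρ₀ ≤ ‖ξ‖ → R ≤ ‖P (γ ξ)‖)
    (hB : ∀ ξ : ℂ, ‖Q (γ ξ)‖ ≤ B) :
    ∃ (Ψ₀ Ψ₀inv : ℂ → E4 →L[ℝ] E4) (C : ℝ), ContDiff ℝ ∞ Ψ₀ ∧ ContDiff ℝ ∞ Ψ₀inv ∧
      (∀ ξ, (Ψ₀inv ξ).comp (Ψ₀ ξ) = ContinuousLinearMap.id ℝ E4) ∧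
      (∀ ξ, (Ψ₀ ξ).comp (Ψ₀inv ξ) = ContinuousLinearMap.id ℝ E4) ∧
      (∀ ξ v, Ψ₀ ξ (eP (Complex.I * P v) + eQ (Complex.I * Q v)) = J (γ ξ) (Ψ₀ ξ v)) ∧
      (∀ ξ, ρ₀ ≤ ‖ξ‖ → Ψ₀ ξ = ContinuousLinearMap.id ℝ E4) ∧
      (∀ ξ, ‖Ψ₀ ξ‖ ≤ C) ∧ (∀ ξ, ‖Ψ₀inv ξ‖ ≤ C) := by
  obtain ⟨hnorm, hPeP, hQeP, hPeQ, hQeQ, -⟩ := id hPQ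
  -- `J` is constant on `‖x‖ ≥ R`
  have hJfar : ∀ x y : E4, R ≤ ‖x‖ → R ≤ ‖y‖ → J x = J y := by
    intro x y hx hy
    ext1 v
    exact PencilDefs.eq_of_apply_eq hPQ (by rw [hJP x hx, hJP y hy]) (by rw [hJQ x hx, hJQ y hy])
  have hnorm_eQ : ∀ c : ℂ, ‖eQ c‖ = ‖c‖ := by
    intro c
    have h2 := hnorm (eQ c)
    rw [hPeQ, hQeQ, norm_zero, zero_pow two_ne_zero, zero_add] at h2
    exact (sq_eq_sq₀ (norm_nonneg _) (norm_nonneg _)).1 h2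
  -- a reference far point
  obtain ⟨xR, hxR⟩ : ∃ xR : E4, ‖xR‖ = R :=
    ⟨eQ (R : ℂ), by rw [hnorm_eQ, Complex.norm_of_nonneg hR.le]⟩
  -- a global bound on `‖J x‖`
  obtain ⟨A₁, hA₁⟩ := (isCompact_closedBall (0 : E4) R).exists_bound_of_continuousOn
    hJs.continuous.continuousOn
  set A : ℝ := max A₁ 1
  have hA : 0 < A := lt_max_of_lt_right one_pos
  have hJA : ∀ x, ‖J x‖ ≤ A := by
    intro x
    refine le_trans ?_ (le_max_left _ _)
    by_cases hx : ‖x‖ ≤ R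
    · exact hA₁ x (mem_closedBall_zero_iff.2 hx)
    · rw [hJfar x xR (le_of_not_ge hx) hxR.ge]
      exact hA₁ xR (mem_closedBall_zero_iff.2 hxR.le)
  -- `J` is globally Lipschitz
  obtain ⟨A₂, hA₂⟩ := (isCompact_closedBall (0 : E4) R).exists_bound_of_continuousOn
    (hJs.continuous_fderiv (by simp)).continuousOn
  have hJd : Differentiable ℝ J := hJs.differentiable (by simp)
  have hfd0 : ∀ x : E4, R < ‖x‖ → fderiv ℝ J x = 0 := by
    intro x hx
    have hev : J =ᶠ[𝓝 x] fun _ => J xR := by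
      filter_upwards [(isOpen_lt continuous_const continuous_norm).mem_nhds hx] with y hy
      exact hJfar y xR (le_of_lt hy) hxR.ge
    rw [hev.fderiv_eq, fderiv_const_apply]
  set A' : ℝ := max A₂ 0
  have hA'0 : 0 ≤ A' := le_max_right _ _
  have hfdb : ∀ x, ‖fderiv ℝ J x‖ ≤ A' := by
    intro x
    by_cases hx : ‖x‖ ≤ R
    · exact (hA₂ x (mem_closedBall_zero_iff.2 hx)).trans (le_max_left _ _)
    · rw [hfd0 x (lt_of_not_ge hx), ContinuousLinearMap.opNorm_zero]
      exact hA'0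
  have hLip : ∀ x y : E4, ‖J x - J y‖ ≤ A' * ‖x - y‖ := fun x y =>
    convex_univ.norm_image_sub_le_of_norm_fderiv_le (fun z _ => hJd z) (fun z _ => hfdb z)
      (mem_univ y) (mem_univ x)
  -- step size and number of steps
  set δ : ℝ := (A * (A' + 1))⁻¹ with hδ_def
  have hδ : 0 < δ := by positivity
  have hδA : A' * δ ≤ A⁻¹ := by
    calc A' * δ ≤ (A' + 1) * δ := by gcongr; linarith
      _ = A⁻¹ := by rw [hδ_def]; field_simp
  obtain ⟨N, hN⟩ := exists_nat_ge ((R + |B|) / δ)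
  have hNδ : R + |B| ≤ N * δ := (div_le_iff₀ hδ).1 hN
  -- the translated points and the sequence of structures
  set xs : ℕ → ℂ → E4 := fun k ξ => γ ξ + eQ ((((N : ℝ) - k) * δ : ℝ) : ℂ) with hxs_def
  set Js : ℕ → ℂ → (E4 →L[ℝ] E4) := fun k ξ => J (xs k ξ) with hJs_def
  have hsq : ∀ k ξ, Js k ξ * Js k ξ = -1 := by
    intro k ξ
    ext1 v
    simp [hJs_def, hJ2]
  have hsm : ∀ k, ContDiff ℝ ∞ (Js k) := fun k => hJs.comp (hγ.add contDiff_const)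
  have hbd : ∀ k ξ, ‖Js k ξ‖ ≤ A := fun k ξ => hJA _
  have hstep : ∀ k ξ, ‖Js k ξ - Js (k + 1) ξ‖ ≤ A⁻¹ := by
    intro k ξ
    have hdiff : xs k ξ - xs (k + 1) ξ = eQ (δ : ℂ) := by
      simp only [hxs_def, add_sub_add_left_eq_sub, ← map_sub, ← Complex.ofReal_sub]
      congr 2
      push_cast
      ring
    calc ‖Js k ξ - Js (k + 1) ξ‖ ≤ A' * ‖xs k ξ - xs (k + 1) ξ‖ := hLip _ _
      _ = A' * δ := by rw [hdiff, hnorm_eQ, Complex.norm_of_nonneg hδ.le]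
      _ ≤ A⁻¹ := hδA
  -- the starting points are far, and for `‖ξ‖ ≥ ρ₀` all points are far
  have hfar0 : ∀ ξ, R ≤ ‖xs 0 ξ‖ := by
    intro ξ
    have hQ : Q (xs 0 ξ) = Q (γ ξ) + (((N : ℝ) * δ : ℝ) : ℂ) := by
      simp [hxs_def, hQeQ]
    have hc : ‖(((N : ℝ) * δ : ℝ) : ℂ)‖ = N * δ := Complex.norm_of_nonneg (by positivity)
    have h1 : (N : ℝ) * δ - ‖Q (γ ξ)‖ ≤ ‖Q (xs 0 ξ)‖ := by
      rw [hQ]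
      have := norm_sub_le (Q (γ ξ) + (((N : ℝ) * δ : ℝ) : ℂ)) (Q (γ ξ))
      rw [add_sub_cancel_left, hc] at this
      linarith
    have h2 := PencilDefs.norm_Q_le hPQ (xs 0 ξ)
    have h3 := hB ξ
    have h4 := le_abs_self B
    linarith
  have hfarρ : ∀ ξ, ρ₀ ≤ ‖ξ‖ → ∀ k, R ≤ ‖xs k ξ‖ := by
    intro ξ hξ k
    have hP : P (xs k ξ) = P (γ ξ) := by simp [hxs_def, hPeQ]
    calc R ≤ ‖P (γ ξ)‖ := hfar ξ hξ
      _ = ‖P (xs k ξ)‖ := by rw [hP]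
      _ ≤ ‖xs k ξ‖ := PencilDefs.norm_P_le hPQ _
  have hxsN : ∀ ξ, xs N ξ = γ ξ := by
    intro ξ
    simp [hxs_def]
  have h1 : ‖(1 : E4 →L[ℝ] E4)‖ ≤ 1 := ContinuousLinearMap.norm_id_le
  -- the trivialisation
  refine ⟨psi Js N, psiInv Js N, 2 ^ N, contDiff_psi Js hsm N,
    contDiff_psiInv Js hsm hA hbd hstep N, fun ξ => psiInv_mul_psi Js hA hbd hstep N ξ,
    fun ξ => psi_mul_psiInv Js hA hbd hstep N ξ, ?_, ?_,
    fun ξ => norm_psi_le Js h1 hA hbd hstep N ξ, fun ξ => norm_psiInv_le Js h1 hA hbd hstep N ξ⟩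
  · -- intertwining
    intro ξ v
    have hI : J (xs 0 ξ) v = eP (Complex.I * P v) + eQ (Complex.I * Q v) :=
      PencilDefs.eq_of_apply_eq hPQ (by rw [hJP _ (hfar0 ξ), map_add, hPeP, hPeQ, add_zero])
        (by rw [hJQ _ (hfar0 ξ), map_add, hQeP, hQeQ, zero_add])
    have h := DFunLike.congr_fun (psi_mul Js hsq N ξ) v
    simp only [mul_apply_eq_comp, hJs_def, hI, hxsN] at h
    exact h
  · -- standard at infinity
    intro ξ hξ
    exact psi_eq_one Js N ξ fun j _ =>
      hJfar _ _ (hfarρ ξ hξ (j + 1)) (hfarρ ξ hξ j)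

end Summit.SmoothPoincare4.SmoothPoincare4.Cruxes.TameOrBrodyR4.Sketch
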